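import Mathlib
import Summits.AtomisticToContinuum.Crystallization.Theses.PhononSlackCertificates
import Summits.AtomisticToContinuum.Crystallization.Theorems.PhononSlackCertificatesNearFarGlueRHoles
import Literature.MathematicalPhysics.StatisticalMechanics.LennardJonesClusters

/-!
# Crux `PhononSlackCertificates.NearFarGlueR` (stmt-AtomisticToContinuum-14970), line `Sketch`:
the ASSEMBLY principle and the MIRROR species of the residual (lattice-free, `e*`-free)

Continuation lead c5.  The registered residual of the line is the tight contact gap (every bad
particle next to good crystal pays `g₂ > 0` against `N·e*`, `e* = ⨅_Q e(Q)`).  Leads c3/c4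
recorded the `e*`-free levers as comparisons `k·e* ≤ 𝓔(comparison configuration)` with `N`
(move), `N − #W` (removal, upper cone `e* ≤ −0.711`) and `N + m` (insertion, lower cone
`e* ≥ −0.7865`) particles, and concluded that "no FINITE comparison configuration certifies
surface energy".  Comparisons with `2N` particles do, exactly and without either cone:

* **assembly principle** (`assembly_principle`): for every finite injective `x` and every
  distance-preserving map `σ` of `ℝ³` with `σ(x)` off `x`,
  `N·e* ≤ 𝓔(x) + ½·Σ_i Σ_l V(|x_i − σ(x_l)|)` — periodisation of the doubled configuration
  `x ⊕ σ(x)` (the insertion principle with `p := σ ∘ x`, `𝓔(σ ∘ x) = 𝓔(x)`); the excess energy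
  of `x` is at least HALF THE BINDING ENERGY between `x` and any congruent disjoint copy;
* **mirror principle** (`mirror_principle`): for the reflection `p ↦ p − 2(⟪p,n⟫ − h)·n` in a
  plane `⟪p,n⟫ = h` (`‖n‖ = 1`) with every particle at signed distance `s_i = ⟪x_i,n⟫ − h ≥ 9/20`,
  all cross distances are `≥ s_i + s_l ≥ 9/10` (so every cross term is `≤ 0`) and each particle
  faces ITS OWN image at distance `2 s_i`, whence `N·e* + ½·Σ_i (−V(2 s_i)) ≤ 𝓔(x)`;
* **mirror species** (`mirror_gap`, `tightContact_ineq_mirror`): every particle with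
  `s_i ∈ [9/20, 147/200]` pays `≥ 1/150` (`V ≤ −1/75` on `[9/10, 147/100]`): the outermost
  layer facing an empty half-space is priced WHATEVER the material — relaxed, strained,
  reconstructed, amorphous — with no reference lattice and no knowledge of `e*`.  For a relaxed
  (111) facet (`s_i = 1/2`, `V(1) = −1/12`) the self-pair alone gives `1/24` per facet atom; the
  full cross sum (`assembly_principle`) ≈ `0.12`, against the true surface energy `≈ 0.17`.

This prices the first species the c4 ledger lists as unpriced (free surfaces of RELAXED crystals:
facet atoms are well-bonded and the sites above them are shallow holes, so neither removal nor
insertion reaches them) — one supporting plane at a time; the slab (two parallel planes) and box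
(six planes) forms follow by iterated doubling (sub-goals `stub_slabMirror`, `stub_boxMirror` of
the skeleton).  What it does NOT reach (recorded so nobody retries it): rough or re-entrant
surfaces atom by atom (only particles within `0.735` of a supporting plane pay), internal
interfaces (grain boundaries, strained cages) — a LOCAL insertion of a mirrored patch brings its
own fresh surface and gains nothing; only GLOBAL copies, whose surface is already paid in `𝓔(x)`,
work.  All `[folklore]`.
-/

noncomputable section

namespace Summit.AtomisticToContinuum.Crystallization.Theorems.PhononSlackCertificatesNearFarGlueR

open Literature.MathematicalPhysics.StatisticalMechanics
open Literature.Geometry.DiscreteGeometry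
open Summit.AtomisticToContinuum.Crystallization.Theses.PhononSlackCertificates
open Summit.AtomisticToContinuum.Crystallization.Theorems.ChargedEnergyGapNegative
  (eStar card_mul_eStar_le)
open scoped BigOperators RealInnerProductSpace

/-! ## §1 The assembly principle -/

/-- A distance-preserving map carries a configuration to one of the same energy. [folklore] -/
theorem interactionEnergy_comp_of_dist_eq {N : ℕ} (x : Fin N → EuclideanSpace ℝ (Fin 3))
    (σ : EuclideanSpace ℝ (Fin 3) → EuclideanSpace ℝ (Fin 3))
    (hσ : ∀ p q, dist (σ p) (σ q) = dist p q) :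
    interactionEnergy lennardJones (σ ∘ x) = interactionEnergy lennardJones x := by
  unfold interactionEnergy
  simp only [Function.comp_apply, hσ]

/-- A distance-preserving map carries an injective configuration to an injective one.
[folklore] -/
theorem injective_comp_of_dist_eq {N : ℕ} {x : Fin N → EuclideanSpace ℝ (Fin 3)}
    (hx : Function.Injective x) (σ : EuclideanSpace ℝ (Fin 3) → EuclideanSpace ℝ (Fin 3))
    (hσ : ∀ p q, dist (σ p) (σ q) = dist p q) : Function.Injective (σ ∘ x) := by
  intro l l' h
  apply hx
  have h0 : dist (σ (x l)) (σ (x l')) = 0 := by rw [dist_eq_zero]; exact h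
  rw [hσ] at h0
  exact dist_eq_zero.1 h0

/-- **Assembly principle.**  For every finite injective configuration `x` of `ℝ³` and every
distance-preserving map `σ` with `σ(x)` off `x`,
`N·e* ≤ 𝓔_LJ(x) + ½·Σ_i Σ_l V(|x_i − σ(x_l)|)`: periodisation of the doubled configuration
`x ⊕ σ(x)` (`insertion_principle` with `p := σ ∘ x` and `𝓔(σ ∘ x) = 𝓔(x)`).  The excess energy
of `x` is at least half its binding energy with any congruent disjoint copy; `e*` enters only
through `2N·e* ≤ 𝓔(x ⊕ σ x)`, so neither cone on `e*` is used. [folklore] -/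
theorem assembly_principle {N : ℕ} (x : Fin N → EuclideanSpace ℝ (Fin 3))
    (hx : Function.Injective x) (σ : EuclideanSpace ℝ (Fin 3) → EuclideanSpace ℝ (Fin 3))
    (hσ : ∀ p q, dist (σ p) (σ q) = dist p q) (hoff : ∀ (l i : Fin N), σ (x l) ≠ x i) :
    (N : ℝ) * (⨅ Q : PeriodicConfiguration 3, Q.energyPerParticle lennardJones) ≤
      interactionEnergy lennardJones x +
        (1 / 2 : ℝ) * ∑ i, ∑ l, lennardJones (dist (x i) (σ (x l))) := by
  have h := insertion_principle x hx (σ ∘ x) (injective_comp_of_dist_eq hx σ hσ) hoff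
  rw [interactionEnergy_comp_of_dist_eq x σ hσ] at h
  simp only [Function.comp_apply] at h
  linarith

/-! ## §2 The mirror principle

The reflection in the plane `⟪p, n⟫ = h` (`‖n‖ = 1`) is written out as
`p ↦ p − (2(⟪p, n⟫ − h)) • n` (no auxiliary definition). -/

/-- The reflection preserves distances (`‖n‖ = 1`). [folklore] -/
theorem dist_mirror_mirror {n : EuclideanSpace ℝ (Fin 3)} (hn : ‖n‖ = 1) (h : ℝ)
    (p q : EuclideanSpace ℝ (Fin 3)) :
    dist (p - (2 * (⟪p, n⟫ - h)) • n) (q - (2 * (⟪q, n⟫ - h)) • n) = dist p q := by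
  have e : (p - (2 * (⟪p, n⟫ - h)) • n) - (q - (2 * (⟪q, n⟫ - h)) • n) =
      (p - q) - (2 * ⟪p - q, n⟫) • n := by
    simp only [inner_sub_left]
    module
  have hsq : ‖(p - (2 * (⟪p, n⟫ - h)) • n) - (q - (2 * (⟪q, n⟫ - h)) • n)‖ ^ 2 =
      ‖p - q‖ ^ 2 := by
    rw [e, norm_sub_sq_real, inner_smul_right, norm_smul, Real.norm_eq_abs, hn, mul_one,
      sq_abs]
    ring
  rw [dist_eq_norm, dist_eq_norm]
  exact (sq_eq_sq₀ (norm_nonneg _) (norm_nonneg _)).1 hsq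

/-- A particle faces its own image at twice its distance from the plane. [folklore] -/
theorem dist_mirror_self {n : EuclideanSpace ℝ (Fin 3)} (hn : ‖n‖ = 1) (h : ℝ)
    (p : EuclideanSpace ℝ (Fin 3)) (hp : 0 ≤ ⟪p, n⟫ - h) :
    dist p (p - (2 * (⟪p, n⟫ - h)) • n) = 2 * (⟪p, n⟫ - h) := by
  have e : p - (p - (2 * (⟪p, n⟫ - h)) • n) = (2 * (⟪p, n⟫ - h)) • n := by abel
  rw [dist_eq_norm, e, norm_smul, hn, mul_one, Real.norm_eq_abs, abs_of_nonneg (by linarith)]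

/-- Cross distances are at least the sum of the two signed distances from the plane.
[folklore] -/
theorem add_le_dist_mirror {n : EuclideanSpace ℝ (Fin 3)} (hn : ‖n‖ = 1) (h : ℝ)
    (p q : EuclideanSpace ℝ (Fin 3)) :
    (⟪p, n⟫ - h) + (⟪q, n⟫ - h) ≤ dist p (q - (2 * (⟪q, n⟫ - h)) • n) := by
  have hnn : ⟪n, n⟫ = (1 : ℝ) := by
    rw [real_inner_self_eq_norm_sq, hn]; norm_num
  have e : ⟪p - (q - (2 * (⟪q, n⟫ - h)) • n), n⟫ = (⟪p, n⟫ - h) + (⟪q, n⟫ - h) := by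
    simp only [inner_sub_left, inner_smul_left, hnn, RCLike.conj_to_real]
    ring
  rw [dist_eq_norm, ← e]
  calc ⟪p - (q - (2 * (⟪q, n⟫ - h)) • n), n⟫ ≤ |⟪p - (q - (2 * (⟪q, n⟫ - h)) • n), n⟫| :=
        le_abs_self _
    _ ≤ ‖p - (q - (2 * (⟪q, n⟫ - h)) • n)‖ * ‖n‖ := abs_real_inner_le_norm _ _
    _ = ‖p - (q - (2 * (⟪q, n⟫ - h)) • n)‖ := by rw [hn, mul_one]

/-- **Mirror principle.**  If every particle of a finite injective configuration lies at signed
distance `⟪x_i, n⟫ − h ≥ 9/20` from the plane `⟪p, n⟫ = h` (`‖n‖ = 1`), then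
`N·e* ≤ 𝓔_LJ(x) + ½·Σ_i V(2(⟪x_i, n⟫ − h))`, i.e. `N·e* + ½·Σ_i (−V(2 s_i)) ≤ 𝓔_LJ(x)`: the
assembly principle for the mirror copy `p ↦ p − 2(⟪p,n⟫ − h)·n`, in which every cross distance
is `≥ 9/10` (cross terms `≤ 0`, dropped) and each particle faces its own image at distance
`2 s_i`. [folklore] -/
theorem mirror_principle {N : ℕ} (x : Fin N → EuclideanSpace ℝ (Fin 3))
    (hx : Function.Injective x) {n : EuclideanSpace ℝ (Fin 3)} (hn : ‖n‖ = 1) (h : ℝ)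
    (hside : ∀ i : Fin N, (9 / 20 : ℝ) ≤ ⟪x i, n⟫ - h) :
    (N : ℝ) * (⨅ Q : PeriodicConfiguration 3, Q.energyPerParticle lennardJones) ≤
      interactionEnergy lennardJones x +
        (1 / 2 : ℝ) * ∑ i, lennardJones (2 * (⟪x i, n⟫ - h)) := by
  have hcross : ∀ i l : Fin N,
      (9 / 10 : ℝ) ≤ dist (x i) (x l - (2 * (⟪x l, n⟫ - h)) • n) := fun i l => by
    have := add_le_dist_mirror hn h (x i) (x l)
    linarith [hside i, hside l]
  have hoff : ∀ (l i : Fin N), (fun p => p - (2 * (⟪p, n⟫ - h)) • n) (x l) ≠ x i :=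
    fun l i heq => by
    have := hcross i l
    simp only [] at heq
    rw [heq, dist_self] at this
    linarith
  have hA := assembly_principle x hx (fun p => p - (2 * (⟪p, n⟫ - h)) • n)
    (dist_mirror_mirror hn h) hoff
  have hrow : ∀ i : Fin N, ∑ l, lennardJones (dist (x i) (x l - (2 * (⟪x l, n⟫ - h)) • n)) ≤
      lennardJones (2 * (⟪x i, n⟫ - h)) := fun i => by
    rw [← Finset.add_sum_erase _ _ (Finset.mem_univ i),
      dist_mirror_self hn h (x i) (by linarith [hside i])]
    have hrest : ∑ l ∈ Finset.univ.erase i,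
        lennardJones (dist (x i) (x l - (2 * (⟪x l, n⟫ - h)) • n)) ≤ 0 :=
      Finset.sum_nonpos fun l _ => lennardJones_nonpos_of_ge_nine_tenths (hcross i l)
    linarith
  have hsum : ∑ i, ∑ l, lennardJones (dist (x i) (x l - (2 * (⟪x l, n⟫ - h)) • n)) ≤
      ∑ i, lennardJones (2 * (⟪x i, n⟫ - h)) := Finset.sum_le_sum fun i _ => hrow i
  linarith

/-- **Registered sub-goal `stub_mirrorGap` of the line `Sketch` (skeleton v6)** — the mirror
principle in closed form (`inner ℝ (x i) n` written out for the registered signature).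
[folklore] -/
theorem stub_mirrorGap :
    ∀ (N : ℕ) (x : Fin N → EuclideanSpace ℝ (Fin 3)), Function.Injective x →
    ∀ (n : EuclideanSpace ℝ (Fin 3)), ‖n‖ = 1 → ∀ h : ℝ,
      (∀ i : Fin N, (9 / 20 : ℝ) ≤ inner ℝ (x i) n - h) →
      (N : ℝ) * (⨅ Q : PeriodicConfiguration 3, Q.energyPerParticle lennardJones) ≤
        interactionEnergy lennardJones x +
          (1 / 2 : ℝ) * ∑ i : Fin N, lennardJones (2 * (inner ℝ (x i) n - h)) :=
  fun _ x hx _ hn h hside => mirror_principle x hx hn h hside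

/-! ## §3 The mirror species: the outermost layer facing a half-space pays -/

/-- **Mirror species.**  Under the hypotheses of `mirror_principle`, every particle with signed
distance `s_i ∈ [9/20, 147/200]` from the plane pays `1/150` (`V ≤ −1/75` on `[9/10, 147/100]`,
`lennardJones_le_of_mem_range`), the others pay `≥ 0`:
`N·e* + (1/150)·#{i : s_i ≤ 147/200} ≤ 𝓔_LJ(x)`.  No lattice, no separation, no cone on `e*`.
[folklore] -/
theorem mirror_gap {N : ℕ} (x : Fin N → EuclideanSpace ℝ (Fin 3))
    (hx : Function.Injective x) {n : EuclideanSpace ℝ (Fin 3)} (hn : ‖n‖ = 1) (h : ℝ)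
    (hside : ∀ i : Fin N, (9 / 20 : ℝ) ≤ ⟪x i, n⟫ - h) :
    (N : ℝ) * (⨅ Q : PeriodicConfiguration 3, Q.energyPerParticle lennardJones) +
      (1 / 150 : ℝ) * ((Finset.univ.filter fun i : Fin N => ⟪x i, n⟫ - h ≤ 147 / 200).card : ℝ)
        ≤ interactionEnergy lennardJones x := by
  have hM := mirror_principle x hx hn h hside
  set S := Finset.univ.filter fun i : Fin N => ⟪x i, n⟫ - h ≤ 147 / 200 with hS
  have hsplit := Finset.sum_filter_add_sum_filter_not Finset.univ
    (fun i : Fin N => ⟪x i, n⟫ - h ≤ 147 / 200) (fun i => lennardJones (2 * (⟪x i, n⟫ - h)))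
  have hin : ∑ i ∈ S, lennardJones (2 * (⟪x i, n⟫ - h)) ≤ ∑ i ∈ S, (-(1 / 75) : ℝ) :=
    Finset.sum_le_sum fun i hi => by
      have hi' := (Finset.mem_filter.1 hi).2
      exact lennardJones_le_of_mem_range (by linarith [hside i]) (by linarith)
  have hout : ∑ i ∈ Finset.univ.filter (fun i : Fin N => ¬ (⟪x i, n⟫ - h ≤ 147 / 200)),
      lennardJones (2 * (⟪x i, n⟫ - h)) ≤ 0 :=
    Finset.sum_nonpos fun i _ => lennardJones_nonpos_of_ge_nine_tenths (by linarith [hside i])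
  rw [Finset.sum_const, nsmul_eq_mul] at hin
  rw [← hS] at hsplit
  linarith

open scoped Classical in
/-- **The mirror species in the residual's currency.**  Under the hypotheses of
`mirror_principle`, the tight contacts (bad particles within `21/20` of a good one) lying within
`147/200` of the supporting plane are priced at `1/150` each. [folklore] -/
theorem tightContact_ineq_mirror {N : ℕ} (x : Fin N → EuclideanSpace ℝ (Fin 3))
    (hx : Function.Injective x) {n : EuclideanSpace ℝ (Fin 3)} (hn : ‖n‖ = 1) (h : ℝ)
    (hside : ∀ i : Fin N, (9 / 20 : ℝ) ≤ ⟪x i, n⟫ - h) :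
    (N : ℝ) * (⨅ Q : PeriodicConfiguration 3, Q.energyPerParticle lennardJones) +
      (1 / 150 : ℝ) * ((Finset.univ.filter fun j : Fin N =>
          (¬ IsTwoShellGood (1 / 20) (47 / 50) 1 x j ∧
            ∃ i : Fin N, IsTwoShellGood (1 / 20) (47 / 50) 1 x i ∧ dist (x i) (x j) ≤ 21 / 20) ∧
          ⟪x j, n⟫ - h ≤ 147 / 200).card : ℝ)
        ≤ interactionEnergy lennardJones x := by
  have hM := mirror_gap x hx hn h hside
  have hsub : (Finset.univ.filter fun j : Fin N =>
          (¬ IsTwoShellGood (1 / 20) (47 / 50) 1 x j ∧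
            ∃ i : Fin N, IsTwoShellGood (1 / 20) (47 / 50) 1 x i ∧ dist (x i) (x j) ≤ 21 / 20) ∧
          ⟪x j, n⟫ - h ≤ 147 / 200) ⊆
      (Finset.univ.filter fun i : Fin N => ⟪x i, n⟫ - h ≤ 147 / 200) := by
    intro j hj
    simp only [Finset.mem_filter, Finset.mem_univ, true_and] at hj ⊢
    exact hj.2
  have hcard := Finset.card_le_card hsub
  have hcast : ((Finset.univ.filter fun j : Fin N =>
          (¬ IsTwoShellGood (1 / 20) (47 / 50) 1 x j ∧
            ∃ i : Fin N, IsTwoShellGood (1 / 20) (47 / 50) 1 x i ∧ dist (x i) (x j) ≤ 21 / 20) ∧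
          ⟪x j, n⟫ - h ≤ 147 / 200).card : ℝ) ≤
      ((Finset.univ.filter fun i : Fin N => ⟪x i, n⟫ - h ≤ 147 / 200).card : ℝ) := by
    exact_mod_cast hcard
  nlinarith

end Summit.AtomisticToContinuum.Crystallization.Theorems.PhononSlackCertificatesNearFarGlueR

end
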